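import Summits.RiemannHypothesis.RiemannHypothesis.Theorems.PfPersistenceF1TemplateAbscissa
import Literature.NumberTheory.LFunctions.PsiOscillationFromZero
import Literature.NumberTheory.LFunctions.MertensConjectureDisproof

/-!
# PF persistence, fake seat 1 — inputs for the Landau step of THEOREM F1-T₁

Unit `pub-rhpf-fake-1` of the `pub-rhpf` cell (mechanism / rigidity campaign; **no RH claims**);
FAKES §1.8.3′, continuation of `PfPersistenceF1TemplateMellin` / `…TemplateAbscissa`.  Inputs of
MV's Landau argument (proof of Thm. 15.3) for the template line density `H_t = templateLD t`:
the local structure `ζ₁'/ζ₁(z₀ + u) = m/u + O(1)` to the right of any point; the comparison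
function `g = c x^a − η H_t`, its linear bound and its transform `c/(s − a) − η N_t(s)/s` on
`Re s > 1`; a gap `δ` separating the finitely many relevant zeros from the ordinates `±t` when no
zero with real part `≥ 1/2` has ordinate `±t`, whence `ζ₁(s + 1/2 ± it) ≠ 0` on the strip
`{Re s > Re ρ₀ − 1/2, |Im s| < 2δ}`; and `N_t(σ)/σ = O(1)` to the right of the abscissa (using
`N_t(0) = 0` when the abscissa is `0`).  Unconditional; nothing about RH.
-/

set_option linter.dupNamespace false

noncomputable section

open Complex Filter Topology Set MeasureTheory Metric

namespace Summit.RiemannHypothesis.RiemannHypothesis.Theorems.PfPersistence.Fake1.TemplateLandau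

open Literature.NumberTheory.LFunctions Literature.NumberTheory.LFunctions.Landau
open Summit.RiemannHypothesis.RiemannHypothesis.Theorems.PfPersistence.Fake1.TemplateMellin
open Summit.RiemannHypothesis.RiemannHypothesis.Theorems.PfPersistence.Fake1.TemplateAbscissa

/-! ## Local structure of `ζ₁'/ζ₁` to the right of any point -/

/-- To the right of any point `z₀`, `ζ₁'/ζ₁(z₀ + u) = m/u + O(1)` as `u ↓ 0`, with `m ≥ 1` when
`ζ₁(z₀) = 0` (and `m = 0` allowed otherwise), and `ζ₁(z₀ + u) ≠ 0`. [folklore] -/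
theorem exists_logDeriv_sub_div_bound (z₀ : ℂ) : ∃ (m : ℕ) (B : ℝ), (riemannZeta₁ z₀ = 0 → 1 ≤ m) ∧
    ∀ᶠ u : ℝ in 𝓝[>] 0, riemannZeta₁ (z₀ + u) ≠ 0 ∧
      ‖deriv riemannZeta₁ (z₀ + u) / riemannZeta₁ (z₀ + u) - m / u‖ ≤ B := by
  have htend : Tendsto (fun u : ℝ ↦ z₀ + (u : ℂ)) (𝓝[>] 0) (𝓝 z₀) := by
    have hc : Continuous (fun u : ℝ ↦ z₀ + (u : ℂ)) := continuous_const.add continuous_ofReal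
    have h := hc.tendsto 0
    simp only [ofReal_zero, add_zero] at h
    exact h.mono_left nhdsWithin_le_nhds
  have e0 : ∀ᶠ u : ℝ in 𝓝[>] 0, 0 < u := self_mem_nhdsWithin
  by_cases h0 : riemannZeta₁ z₀ = 0
  · obtain ⟨m, h, r, hm, hr, hha, hh0, hhne, -, hfac, hlog⟩ := exists_logDeriv_riemannZeta₁_eq h0
    have hDc : ContinuousAt (fun z ↦ deriv h z / h z) z₀ :=
      hha.deriv.continuousAt.div hha.continuousAt hh0
    set B : ℝ := ‖deriv h z₀ / h z₀‖ + 1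
    have hDev : ∀ᶠ z in 𝓝 z₀, ‖deriv h z / h z‖ ≤ B :=
      (hDc.norm.eventually (eventually_lt_nhds (by linarith : ‖deriv h z₀ / h z₀‖ < B))).mono
        fun z hz ↦ hz.le
    refine ⟨m, B, fun _ ↦ hm, ?_⟩
    filter_upwards [e0, htend.eventually hDev,
      htend.eventually (isOpen_ball.mem_nhds (mem_ball_self hr))] with u hu hB hball
    have hne : z₀ + (u : ℂ) ≠ z₀ := by
      intro h; have := congrArg Complex.re h; simp at this; exact hu.ne' this
    refine ⟨?_, ?_⟩
    · rw [hfac _ hball]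
      exact mul_ne_zero (pow_ne_zero _ (sub_ne_zero.2 hne)) (hhne _ hball)
    · rw [hlog _ hball hne, add_sub_cancel_left, add_sub_cancel_left]
      · exact hB
  · have hc : ContinuousAt (fun z ↦ deriv riemannZeta₁ z / riemannZeta₁ z) z₀ :=
      (differentiable_riemannZeta₁.analyticAt z₀).deriv.continuousAt.div
        (differentiable_riemannZeta₁ z₀).continuousAt h0
    set B : ℝ := ‖deriv riemannZeta₁ z₀ / riemannZeta₁ z₀‖ + 1
    have hDev : ∀ᶠ z in 𝓝 z₀, ‖deriv riemannZeta₁ z / riemannZeta₁ z‖ ≤ B :=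
      (hc.norm.eventually (eventually_lt_nhds
        (by linarith : ‖deriv riemannZeta₁ z₀ / riemannZeta₁ z₀‖ < B))).mono fun z hz ↦ hz.le
    have hne : ∀ᶠ z in 𝓝 z₀, riemannZeta₁ z ≠ 0 :=
      (differentiable_riemannZeta₁ z₀).continuousAt.eventually_ne h0
    refine ⟨0, B, fun h ↦ (h0 h).elim, ?_⟩
    filter_upwards [htend.eventually hDev, htend.eventually hne] with u hB hz
    exact ⟨hz, by simpa using hB⟩

/-! ## The comparison function and its transform -/

/-- `g(x) = c x^{a} − η H_t(x)`. [folklore] -/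
def cmpFn (t c a η : ℝ) (x : ℝ) : ℝ := c * x ^ a - η * templateLD t x

/-- Measurability of `g`. [folklore] -/
theorem measurable_cmpFn (t c a η : ℝ) : Measurable (cmpFn t c a η) :=
  (measurable_const.mul (measurable_id.pow_const _)).sub
    (measurable_const.mul (measurable_templateLD t))

/-- The linear bound `|H_t(x)| ≤ (|A(t)| + 2(log 4 + 4) + 4)·x` for `x ≥ 1`. [folklore] -/
theorem abs_templateLD_le (t : ℝ) {x : ℝ} (hx : 1 ≤ x) :
    |templateLD t x| ≤ (|tmplA t| + 2 * (Real.log 4 + 4) + 4) * x := by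
  have h1 := abs_tmplC_le (t := t) (x := x) (by linarith)
  have h2 := abs_tmplP_le (t := t) hx
  have h3 : |tmplA t| ≤ |tmplA t| * x := le_mul_of_one_le_right (abs_nonneg _) hx
  unfold templateLD
  calc |tmplA t - 2 * tmplC t x + tmplP t x|
      ≤ |tmplA t| + 2 * |tmplC t x| + |tmplP t x| := by
        refine (abs_add_le _ _).trans ?_
        gcongr
        refine (abs_sub _ _).trans ?_
        rw [abs_mul, abs_two]
    _ ≤ (|tmplA t| + 2 * (Real.log 4 + 4) + 4) * x := by nlinarith

/-- `|g(x)| ≤ (c + |A| + 2(log 4 + 4) + 4)·x` for `x > 1` (`0 ≤ c`, `a ≤ 1`, `η = ±1`). [folklore] -/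
theorem abs_cmpFn_le {t c a η : ℝ} (hc : 0 ≤ c) (ha : a ≤ 1) (hη : η = 1 ∨ η = -1) {x : ℝ}
    (hx : 1 < x) : |cmpFn t c a η x| ≤ (c + (|tmplA t| + 2 * (Real.log 4 + 4) + 4)) * x := by
  have hx0 : 0 < x := by linarith
  have hpow : x ^ a ≤ x := by
    calc x ^ a ≤ x ^ (1 : ℝ) := Real.rpow_le_rpow_of_exponent_le hx.le ha
      _ = x := Real.rpow_one x
  have hηabs : |η| = 1 := by rcases hη with rfl | rfl <;> norm_num
  have hH := abs_templateLD_le t hx.le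
  unfold cmpFn
  calc |c * x ^ a - η * templateLD t x| ≤ |c * x ^ a| + |η * templateLD t x| := abs_sub _ _
    _ = c * x ^ a + |templateLD t x| := by
        rw [abs_mul, abs_mul, hηabs, one_mul, abs_of_nonneg hc,
          abs_of_nonneg (Real.rpow_nonneg hx0.le _)]
    _ ≤ c * x + (|tmplA t| + 2 * (Real.log 4 + 4) + 4) * x := by gcongr
    _ = (c + (|tmplA t| + 2 * (Real.log 4 + 4) + 4)) * x := by ring

/-- The continuation `Φ(s) = c/(s − a) − η N_t(s)/s`. [folklore] -/
def cont (t c a η : ℝ) (s : ℂ) : ℂ := c / (s - a) - η * (tmplN t s / s)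

/-- **Transform of `g` on `Re s > 1`** (`0 ≤ a ≤ 1`): `M[g](s) = c/(s − a) − η N_t(s)/s`. [folklore] -/
theorem mellinIoi_cmpFn {t c a η : ℝ} (ha1 : a ≤ 1) {s : ℂ} (hs : 1 < s.re) :
    mellinIoi (cmpFn t c a η) s = cont t c a η s := by
  have hIpow : Integrable (fun x : ℝ ↦ ((c * x ^ a : ℝ) : ℂ) * (x : ℂ) ^ (-(s + 1)))
      (volume.restrict (Ioi 1)) := by
    refine integrable_piece (f := fun x ↦ c * x ^ a)
      (measurable_const.mul (measurable_id.pow_const _)) (K := |c|) (fun x hx ↦ ?_) hs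
    have hx0 : 0 < x := by linarith
    rw [abs_mul, abs_of_nonneg (Real.rpow_nonneg hx0.le _)]
    gcongr
    calc x ^ a ≤ x ^ (1 : ℝ) := Real.rpow_le_rpow_of_exponent_le hx.le ha1
      _ = x := Real.rpow_one x
  have hIH : Integrable (fun x : ℝ ↦ ((η * templateLD t x : ℝ) : ℂ) * (x : ℂ) ^ (-(s + 1)))
      (volume.restrict (Ioi 1)) := by
    refine integrable_piece (f := fun x ↦ η * templateLD t x)
      (measurable_const.mul (measurable_templateLD t))
      (K := |η| * (|tmplA t| + 2 * (Real.log 4 + 4) + 4)) (fun x hx ↦ ?_) hs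
    rw [abs_mul, mul_assoc]
    gcongr
    exact abs_templateLD_le t hx.le
  unfold cmpFn cont
  rw [Nicolas.mellinIoi_sub' hIpow hIH, Nicolas.mellinIoi_const_mul, Nicolas.mellinIoi_const_mul,
    PsiOmega.mellinIoi_rpow (lt_of_le_of_lt ha1 hs), mellinIoi_templateLD t hs]
  ring

/-! ## A gap `δ` separating the relevant zeros from the ordinates `±t` -/

/-- If no zero of `ζ` with real part `≥ 1/2` has ordinate `±t`, there is `0 < δ ≤ 1/2` with
`|γ ∓ t| ≥ 2δ` for every zero `β + iγ` with `1/2 ≤ β < 1`, `|γ| < |t| + 2`. [folklore] -/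
theorem exists_gap {t : ℝ} (ht : ∀ ρ : ℂ, riemannZeta ρ = 0 → 1 / 2 ≤ ρ.re → ρ.im ≠ t ∧ ρ.im ≠ -t) :
    ∃ δ : ℝ, 0 < δ ∧ δ ≤ 1 / 2 ∧ ∀ ρ ∈ zetaZerosBelow (|t| + 2), 1 / 2 ≤ ρ.re →
      2 * δ ≤ |ρ.im - t| ∧ 2 * δ ≤ |ρ.im + t| := by
  classical
  set f : ℂ → ℝ := fun ρ ↦
    if riemannZeta ρ = 0 ∧ 1 / 2 ≤ ρ.re then min |ρ.im - t| |ρ.im + t| else 1 with hf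
  have hfpos : ∀ ρ, 0 < f ρ := by
    intro ρ
    simp only [hf]
    split_ifs with h
    · obtain ⟨h1, h2⟩ := ht ρ h.1 h.2
      exact lt_min (abs_pos.2 (sub_ne_zero.2 h1)) (abs_pos.2 (by
        intro h'; exact h2 (by linarith)))
    · exact one_pos
  have key : ∀ S : Finset ℂ, ∃ δ : ℝ, 0 < δ ∧ δ ≤ 1 / 2 ∧ ∀ ρ ∈ S, 2 * δ ≤ f ρ := by
    intro S
    induction S using Finset.induction_on with
    | empty => exact ⟨1 / 2, by norm_num, le_rfl, by simp⟩
    | @insert a S _ ih =>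
      obtain ⟨δ, hδ0, hδ1, hδ⟩ := ih
      refine ⟨min δ (f a / 2), lt_min hδ0 (by linarith [hfpos a]), (min_le_left _ _).trans hδ1,
        fun ρ hρ ↦ ?_⟩
      rcases Finset.mem_insert.1 hρ with rfl | hρ
      · linarith [min_le_right δ (f ρ / 2)]
      · linarith [min_le_left δ (f a / 2), hδ ρ hρ]
  obtain ⟨δ, hδ0, hδ1, hδ⟩ := key (zetaZerosBelow_finite (|t| + 2)).toFinset
  refine ⟨δ, hδ0, hδ1, fun ρ hρ hre ↦ ?_⟩
  have h := hδ ρ ((Set.Finite.mem_toFinset _).2 hρ)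
  have hif : f ρ = min |ρ.im - t| |ρ.im + t| := by
    simp only [hf, if_pos (And.intro hρ.1 hre)]
  rw [hif] at h
  exact ⟨h.trans (min_le_left _ _), h.trans (min_le_right _ _)⟩

/-- `ζ₁(s + 1/2 + iτ) ≠ 0` for `Re s > a₀ = Re ρ₀ − 1/2 ≥ 0`, `|Im s| < 2δ`, `τ = ±t`, with `δ` as in
`exists_gap`. [folklore] -/
theorem zeta₁_shift_ne_zero {t δ b : ℝ} {w : ℂ} (hw : w = wone t ∨ w = wzero t) (hδ1 : δ ≤ 1 / 2)
    (hb : 1 / 2 ≤ b)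
    (hδ : ∀ ρ ∈ zetaZerosBelow (|t| + 2), 1 / 2 ≤ ρ.re → 2 * δ ≤ |ρ.im - t| ∧ 2 * δ ≤ |ρ.im + t|)
    {s : ℂ} (hs : b - 1 / 2 < s.re) (him1 : -(2 * δ) < s.im) (him2 : s.im < 2 * δ) :
    riemannZeta₁ (s + w) ≠ 0 := by
  have hwre : w.re = 1 / 2 := by rcases hw with rfl | rfl <;> simp [wone, wzero]
  have hwim : w.im = t ∨ w.im = -t := by rcases hw with rfl | rfl <;> simp [wone, wzero]
  have hτ : |w.im| = |t| := by rcases hwim with h | h <;> simp [h]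
  set ρ : ℂ := s + w with hρ
  have hre : ρ.re = s.re + 1 / 2 := by simp [hρ, hwre]
  have him : ρ.im = s.im + w.im := by simp [hρ]
  by_cases hρ1 : ρ = 1
  · rw [hρ1, riemannZeta₁_one]; exact one_ne_zero
  by_cases h1 : 1 ≤ ρ.re
  · rw [Ne, riemannZeta₁_eq_zero_iff hρ1]; exact riemannZeta_ne_zero_of_one_le_re h1
  rw [not_le] at h1
  rw [Ne, riemannZeta₁_eq_zero_iff hρ1]
  intro hz
  have hmem : ρ ∈ zetaZerosBelow (|t| + 2) := by
    refine ⟨hz, by linarith, h1, ?_⟩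
    rw [him]
    calc |s.im + w.im| ≤ |s.im| + |w.im| := abs_add_le _ _
      _ < 2 * δ + |t| := by rw [hτ]; gcongr; exact abs_lt.2 ⟨him1, him2⟩
      _ ≤ |t| + 2 := by linarith
  obtain ⟨h2, h3⟩ := hδ ρ hmem (by linarith)
  have hsim : |s.im| < 2 * δ := abs_lt.2 ⟨him1, him2⟩
  rcases hwim with hτ' | hτ'
  · have : ρ.im - t = s.im := by rw [him, hτ']; ring
    rw [this] at h2; linarith
  · have : ρ.im + t = s.im := by rw [him, hτ']; ring
    rw [this] at h3; linarith


/-! ## `N_t(σ)/σ` stays bounded to the right of the abscissa -/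

/-- `‖N_t(a+u)/(a+u)‖ = O(1)` as `u ↓ 0`, for `a ≥ 0` with `ζ₁(a + w₁) ζ₁(a + w₀) ≠ 0` and, when
`a = 0`, `N_t(0) = 0`. [folklore] -/
theorem exists_bound_tmplN_div {t a : ℝ} (ha : 0 ≤ a)
    (h1 : riemannZeta₁ ((a : ℂ) + wone t) ≠ 0) (h0 : riemannZeta₁ ((a : ℂ) + wzero t) ≠ 0)
    (hz : a = 0 → tmplN t 0 = 0) :
    ∃ C₁ : ℝ, ∀ᶠ u : ℝ in 𝓝[>] 0, ‖tmplN t ((a + u : ℝ) : ℂ) / ((a + u : ℝ) : ℂ)‖ ≤ C₁ := by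
  have hN : AnalyticAt ℂ (tmplN t) (a : ℂ) := analyticAt_tmplN h1 h0
  have htend : Tendsto (fun u : ℝ ↦ ((a + u : ℝ) : ℂ)) (𝓝[>] 0) (𝓝 (a : ℂ)) := by
    have hc : Continuous (fun u : ℝ ↦ ((a + u : ℝ) : ℂ)) :=
      continuous_ofReal.comp (continuous_const.add continuous_id)
    have h := hc.tendsto 0
    simp only [add_zero] at h
    exact h.mono_left nhdsWithin_le_nhds
  rcases ha.eq_or_lt with hzero | hpos
  · -- `a = 0`: the slope `N(u)/u → N'(0)`
    have ha0 : a = 0 := hzero.symm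
    subst ha0
    have hN0 : tmplN t 0 = 0 := hz rfl
    have hd : HasDerivAt (tmplN t) (deriv (tmplN t) 0) 0 := by
      have := hN.differentiableAt.hasDerivAt; simpa using this
    have hsl := hd.tendsto_slope_zero
    have hof : Tendsto (fun u : ℝ ↦ (u : ℂ)) (𝓝[>] 0) (𝓝[≠] 0) := by
      refine tendsto_nhdsWithin_iff.2 ⟨?_, ?_⟩
      · have := (continuous_ofReal.tendsto (0 : ℝ)).mono_left (nhdsWithin_le_nhds (s := Ioi 0))
        simpa using this
      · filter_upwards [self_mem_nhdsWithin] with u (hu : 0 < u)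
        exact ofReal_ne_zero.2 hu.ne'
    have hcomp := hsl.comp hof
    set B : ℝ := ‖deriv (tmplN t) 0‖ + 1
    have hev : ∀ᶠ z in 𝓝 (deriv (tmplN t) 0), ‖z‖ ≤ B :=
      (continuous_norm.continuousAt.eventually (eventually_lt_nhds
        (by linarith : ‖deriv (tmplN t) 0‖ < B))).mono fun z hz ↦ hz.le
    refine ⟨B, ?_⟩
    filter_upwards [hcomp.eventually hev] with u hu
    simpa [Function.comp, hN0, div_eq_inv_mul] using hu
  · -- `a > 0`: continuity of `N(s)/s` at `a`
    have hc : ContinuousAt (fun z : ℂ ↦ tmplN t z / z) (a : ℂ) :=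
      hN.continuousAt.div continuousAt_id (ofReal_ne_zero.2 hpos.ne')
    set B : ℝ := ‖tmplN t a / a‖ + 1
    have hev : ∀ᶠ z in 𝓝 (a : ℂ), ‖tmplN t z / z‖ ≤ B :=
      (hc.norm.eventually (eventually_lt_nhds (by linarith : ‖tmplN t a / a‖ < B))).mono
        fun z hz ↦ hz.le
    exact ⟨B, htend.eventually hev⟩

end Summit.RiemannHypothesis.RiemannHypothesis.Theorems.PfPersistence.Fake1.TemplateLandau
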